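import Summits.QuantumFields.YangMills.Theorems.UnitScaleTiltProp7CovariantBlockPoincare
import HarnessLib

/-!
# Route `UnitScaleTilt`, crux K1 «MinimiserStabilityRegPr» (stmt-QuantumFields-19200), route-R [RP] at a curved background — THE CURVED N6,
# ROW (R-B), PART 3: THE MEAN-SUBTRACTED COMB-GAUGE BLOCK POINCARÉ INEQUALITY — the oscillation of the FRAME-READ field around its transported block
# mean is controlled by the covariant gradient energy on the block, with a curvature defect proportional to the field (no mean term, no `(1−η)⁻¹`)

Cell `ym3-torus`, D-0154 (3c) R3 twin-width seat `ym-routeR-w2` (W-SEAT MAP pass #3 row M9: «(R-B) instantiation»); third file of the (R-B) chain after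
✓ `UnitScaleTiltProp7CovCombMeanCentred` (centring with abstract frames) and `UnitScaleTiltProp7CovIterLambdaBound` (propagation + tower junction).
THEOREMS ONLY (0 `def`, 0 `sorry`); `--supports stmt-QuantumFields-19200`, count-neutral.  YM₃ on T³ is a ladder rung (R3), not the Clay problem; nothing here
claims the curved N6 bound, S2, P, the crux or the gap.

WHY.  `Prop7CovCombMeanCentred.norm_covCombMean_le_osc` bounds the per-level term `‖CM_j(G_j)(z)‖` of the curved structure theorem's gauge function by
`(d+2)L·(o + 2θB)`, `o` the OSCILLATION of the frame-read field `τ(b₋)G_j(b)τ(b₋)*` around direction constants on `B(z)`.  This file supplies `o` from the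
tree's comb-gauge cube Poincaré inequality `Prop7CovariantCoercivity.block_poincare_comb` ([Balaban1983RegularityDecay] (2.27) at a unitary background with
plaquette variables within `a` of `1`, comb frames from the block corner): applied to the field MINUS ITS TRANSPORTED BLOCK MEAN, the mean term vanishes, the
covariant differences of the transported constant are comb-loop defects `≤ 2·dna·‖m‖` (`B7Prop1Explicit.axial_bond_bound`), and the `Σ‖f‖²`-proportional
defect of the tree inequality is absorbed WITHOUT a smallness condition (`S ≤ 4Σ‖F‖²`):
`Σ_r ‖R(v_r)F(r) − m‖² ≤ (N/2)(L^e)²·Σ_ν Σ_{r,r+e_ν∈B} ‖R(V(x_r,ν))F(r+e_ν) − F(r)‖² + 6N·d³n²(L^e)²a²·Σ_r ‖F(r)‖²`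
(`n + 1 = L^e`, `v_r = V(Γ_{ȳ,x_r})` the comb transport from the corner `ȳ`, `m = L^{−ed}Σ_r R(v_r)F(r)` the transported block mean, `R(u)X = uXu⁻¹`), for
OFFSET-INDEXED `F` (the form the level-`j` comb step consumes, `e = 1`), with the sup and Jensen corollaries.

WHAT IS PROVED (ns `…Theorems.Prop7CovBlockPoincareCentred`).
* §1 `bsite_injective`; `norm_conjR_inv_frame_step_le` — the covariant difference of the back-transported constant is a comb-loop defect:
  `‖R(V(x_r,ν))R(v_{r+e_ν}⁻¹)m − R(v_r⁻¹)m‖ ≤ 2·|r|₁a·‖m‖`; `normSq_mean_le` (Jensen for the transported mean).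
* §2 ★★ `sum_normSq_conj_sub_mean_le` — the displayed inequality; ★ `normSq_conj_sub_mean_le_sum` (each term ≤ the sum: the SUP form feeding `hosc`).
HONEST SCOPE.  One block, one level, bookkeeping over two tree estimates; nothing of Bałaban's analysis is asserted beyond them.

References: T. Bałaban, CMP 89 (1983) 571–597 [Balaban1983RegularityDecay] ((2.27) p.580); CMP 98 (1985) 17–51 [Balaban1985Averaging] (pp.24–25, (56) p.27);
CMP 95 (1984) 17–40 [Balaban1984PropagatorsI] ((1.18) p.20).
-/

noncomputable section

open scoped BigOperators Matrix.Norms.L2Operator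

namespace Summit.QuantumFields.YangMills.Theorems.Prop7CovBlockPoincareCentred

open Literature.MathematicalPhysics.QuantumFieldTheory.Balaban1983to89
open Finset B1RG242Torus
open B7Prop1Explicit renaming Site → LSite
open B7Prop1Explicit (Letter e hol treeWord axialFn plaqWord l1 U1 gaugeAct axial_bond_bound hol_mem)
open B7Eq78Linearization (conjR conjR_apply conjR_sub conjR_add conjR_smul_real)
open B8Ineq132 (norm_conjR conjR_conjR one_conjR conjR_sum)
open B10Eq27TorusAxialLog (transl pull pull_apply holT hol_pull hol_pull_zero)
open Beta.CoordCubePoincare (stepUp)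
open B5Leaf237C0Torus (bsite bsite_stepUp)
open Summit.QuantumFields.YangMills.Theorems.Prop7CovariantCoercivity (block_poincare_comb bsite_eq_transl intVec_stepUp l1_intVec_le holT_mem)

variable {N : ℕ} [NeZero N] {P : Params} {i i' e n : ℕ}

/-! ## §1 Letters: injectivity of the offset chart, the comb-loop defect of the back-transported constant, Jensen for the transported mean -/

/-- The offset chart of a block is injective (labels `y_μL^e + r_μ`, no wrap-around in the standing range). [folklore] -/
theorem bsite_injective (h : P.sitesPerDir i = P.L ^ e * P.sitesPerDir i') (hn : n + 1 = P.L ^ e) (y : Site P i') :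
    Function.Injective (bsite P i e hn y) := by
  intro r r' hrr
  funext μ
  have hv := congrArg (fun x : Site P i => (x μ).val) hrr
  simp only [bsite, Site.val_fibreSite h, Fin.val_cast, add_right_inj] at hv
  exact Fin.ext hv

/-- **THE COVARIANT DIFFERENCE OF THE BACK-TRANSPORTED CONSTANT IS A COMB-LOOP DEFECT**: with `v_r = V(Γ_{ȳ,x_r})`,
`‖R(V(x_r, ν))·R(v_{r+e_ν}⁻¹)m − R(v_r⁻¹)m‖ ≤ 2·(|r|₁a)·‖m‖` — the loop `Γ_{ȳ,x_r} ∪ (x_r, x_r+e_ν) ∪ (−Γ_{ȳ,x_r+e_ν})` is the axial-gauge bond variable, within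
`|r|₁a` of `1` (`B7Prop1Explicit.axial_bond_bound`). [cite: Balaban1985Averaging, pp.24–25] -/
theorem norm_conjR_inv_frame_step_le {V : GaugeField P i (Matrix (Fin N) (Fin N) ℂ)ˣ} (hV : ∀ b, V b ∈ U1 (Matrix (Fin N) (Fin N) ℂ)) {a : ℝ}
    (ha : 0 ≤ a) (hplaq : ∀ (x : Site P i) (κ μ : Fin P.d), κ ≠ μ → ‖((holT V x (plaqWord κ μ) : (Matrix (Fin N) (Fin N) ℂ)ˣ) : Matrix (Fin N) (Fin N) ℂ) - 1‖ ≤ a)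
    (ybar : Site P i) (z : LSite P.d) (ν : Fin P.d) (m : Matrix (Fin N) (Fin N) ℂ) :
    ‖conjR (V ⟨transl ybar z, ν⟩) (conjR (holT V ybar (treeWord (z + B7Prop1Explicit.e ν)))⁻¹ m) - conjR (holT V ybar (treeWord z))⁻¹ m‖
      ≤ 2 * (l1 z * a) * ‖m‖ := by
  -- the axial-gauge bond defect for the pullback based at `ȳ` (as in `Prop7CovariantCoercivity.norm_conjR_comb_sub_le`)
  set W : LSite P.d → Fin P.d → (Matrix (Fin N) (Fin N) ℂ)ˣ := pull V ybar with hW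
  have hWm : ∀ x κ, W x κ ∈ U1 (Matrix (Fin N) (Fin N) ℂ) := fun x κ => hV _
  have h44 : ∀ (x : LSite P.d) (κ μ : Fin P.d), κ ≠ μ → ‖((hol W x (plaqWord κ μ) : (Matrix (Fin N) (Fin N) ℂ)ˣ) : Matrix (Fin N) (Fin N) ℂ) - 1‖ ≤ a := by
    intro x κ μ hne
    rw [hW, hol_pull]
    exact hplaq _ κ μ hne
  have hbond := axial_bond_bound W hWm 0 h44 ha z ν
  rw [sub_zero] at hbond
  set v₀ : (Matrix (Fin N) (Fin N) ℂ)ˣ := holT V ybar (treeWord z) with hv₀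
  set v₁ : (Matrix (Fin N) (Fin N) ℂ)ˣ := holT V ybar (treeWord (z + B7Prop1Explicit.e ν)) with hv₁
  set g : (Matrix (Fin N) (Fin N) ℂ)ˣ := V ⟨transl ybar z, ν⟩ with hg
  have hv₀' : axialFn W 0 z = v₀ := by rw [axialFn, sub_zero, hW, hol_pull_zero]
  have hv₁' : axialFn W 0 (z + B7Prop1Explicit.e ν) = v₁ := by rw [axialFn, sub_zero, hW, hol_pull_zero]
  have hg' : W z ν = g := by rw [hW, pull_apply]
  have hga : gaugeAct (axialFn W 0) W z ν = v₀ * g * v₁⁻¹ := by rw [gaugeAct, hv₀', hv₁', hg']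
  rw [hga] at hbond
  have hv₀m : v₀ ∈ U1 (Matrix (Fin N) (Fin N) ℂ) := holT_mem hV _ _
  have hv₁m : v₁ ∈ U1 (Matrix (Fin N) (Fin N) ℂ) := holT_mem hV _ _
  have hgm : g ∈ U1 (Matrix (Fin N) (Fin N) ℂ) := hV _
  -- `‖g v₁⁻¹ − v₀⁻¹‖ ≤ ‖v₀ g v₁⁻¹ − 1‖ ≤ |z|₁ a`
  have hdiff : ‖((g * v₁⁻¹ : (Matrix (Fin N) (Fin N) ℂ)ˣ) : Matrix (Fin N) (Fin N) ℂ) - ((v₀⁻¹ : (Matrix (Fin N) (Fin N) ℂ)ˣ) : Matrix (Fin N) (Fin N) ℂ)‖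
      ≤ l1 z * a := by
    have hid : ((g * v₁⁻¹ : (Matrix (Fin N) (Fin N) ℂ)ˣ) : Matrix (Fin N) (Fin N) ℂ) - ((v₀⁻¹ : (Matrix (Fin N) (Fin N) ℂ)ˣ) : Matrix (Fin N) (Fin N) ℂ)
        = ((v₀⁻¹ : (Matrix (Fin N) (Fin N) ℂ)ˣ) : Matrix (Fin N) (Fin N) ℂ) * (((v₀ * g * v₁⁻¹ : (Matrix (Fin N) (Fin N) ℂ)ˣ) : Matrix (Fin N) (Fin N) ℂ) - 1) := by
      have hgrp : v₀⁻¹ * (v₀ * g * v₁⁻¹) = g * v₁⁻¹ := by group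
      rw [mul_sub, mul_one, ← Units.val_mul, hgrp]
    rw [hid]
    calc _ ≤ ‖((v₀⁻¹ : (Matrix (Fin N) (Fin N) ℂ)ˣ) : Matrix (Fin N) (Fin N) ℂ)‖ * ‖((v₀ * g * v₁⁻¹ : (Matrix (Fin N) (Fin N) ℂ)ˣ) : Matrix (Fin N) (Fin N) ℂ) - 1‖ :=
          norm_mul_le _ _
      _ ≤ 1 * (l1 z * a) := by gcongr; exact hv₀m.2
      _ = l1 z * a := one_mul _
  rw [conjR_conjR]
  have h := Prop7CovariantCoercivity.norm_conjR_sub_conjR_le ((U1 _).inv_mem hv₀m) ((U1 _).mul_mem hgm ((U1 _).inv_mem hv₁m)) m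
  refine h.trans ?_
  have hm0 : 0 ≤ ‖m‖ := norm_nonneg _
  nlinarith [hdiff]

/-- **JENSEN FOR THE TRANSPORTED BLOCK MEAN**: `|B|·‖m‖² ≤ Σ_r ‖F(r)‖²` for `m = |B|⁻¹Σ_r R(v_r)F(r)` (`‖R(v_r)F‖ = ‖F‖`, Cauchy–Schwarz). [folklore] -/
theorem normSq_mean_le {V : GaugeField P i (Matrix (Fin N) (Fin N) ℂ)ˣ} (hV : ∀ b, V b ∈ U1 (Matrix (Fin N) (Fin N) ℂ))
    (hn : n + 1 = P.L ^ e) (y : Site P i') (F : (Fin P.d → Fin (n + 1)) → Matrix (Fin N) (Fin N) ℂ) :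
    ((n : ℝ) + 1) ^ P.d * ‖(((n : ℝ) + 1) ^ P.d)⁻¹ • ∑ r : Fin P.d → Fin (n + 1),
        conjR (holT V (bsite P i e hn y fun _ => 0) (treeWord fun ν => ((r ν : ℕ) : ℤ))) (F r)‖ ^ 2
      ≤ ∑ r : Fin P.d → Fin (n + 1), ‖F r‖ ^ 2 := by
  set Vol : ℝ := ((n : ℝ) + 1) ^ P.d with hVol
  have hVol0 : 0 < Vol := by positivity
  have hcard : ((Finset.univ : Finset (Fin P.d → Fin (n + 1))).card : ℝ) = Vol := by
    rw [Finset.card_univ, Fintype.card_fun, Fintype.card_fin, Fintype.card_fin, hVol]; push_cast; ring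
  have hsum : ‖∑ r : Fin P.d → Fin (n + 1), conjR (holT V (bsite P i e hn y fun _ => 0) (treeWord fun ν => ((r ν : ℕ) : ℤ))) (F r)‖
      ≤ ∑ r : Fin P.d → Fin (n + 1), ‖F r‖ := by
    refine (norm_sum_le _ _).trans (le_of_eq (Finset.sum_congr rfl fun r _ => ?_))
    exact norm_conjR (holT_mem hV _ _) _
  have hcs := sq_sum_le_card_mul_sum_sq (s := (Finset.univ : Finset (Fin P.d → Fin (n + 1)))) (f := fun r => ‖F r‖)
  rw [hcard] at hcs
  rw [norm_smul, norm_inv, Real.norm_of_nonneg hVol0.le, mul_pow, inv_pow]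
  have h0 : 0 ≤ ‖∑ r : Fin P.d → Fin (n + 1), conjR (holT V (bsite P i e hn y fun _ => 0) (treeWord fun ν => ((r ν : ℕ) : ℤ))) (F r)‖ := norm_nonneg _
  have h1 := pow_le_pow_left₀ h0 hsum 2
  calc Vol * ((Vol ^ 2)⁻¹ * ‖∑ r : Fin P.d → Fin (n + 1), conjR (holT V (bsite P i e hn y fun _ => 0) (treeWord fun ν => ((r ν : ℕ) : ℤ))) (F r)‖ ^ 2)
      = Vol⁻¹ * ‖∑ r : Fin P.d → Fin (n + 1), conjR (holT V (bsite P i e hn y fun _ => 0) (treeWord fun ν => ((r ν : ℕ) : ℤ))) (F r)‖ ^ 2 := by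
        field_simp
    _ ≤ Vol⁻¹ * (Vol * ∑ r : Fin P.d → Fin (n + 1), ‖F r‖ ^ 2) := mul_le_mul_of_nonneg_left (h1.trans hcs) (inv_pos.mpr hVol0).le
    _ = ∑ r : Fin P.d → Fin (n + 1), ‖F r‖ ^ 2 := by field_simp

/-! ## §2 ★★ The mean-subtracted comb-gauge block Poincaré inequality -/

set_option maxHeartbeats 400000 in
/-- ★★ **THE MEAN-SUBTRACTED COMB-GAUGE BLOCK POINCARÉ INEQUALITY** on one block `B^e(y)` (side `n + 1 = L^e`) of `T^{(i)}`, at a unitary background `V` with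
plaquette variables within `a` of `1`, for an OFFSET-INDEXED field `F`: with `v_r = V(Γ_{ȳ,x_r})` the comb transport from the corner and
`m = L^{−ed}Σ_r R(v_r)F(r)` the transported block mean,
`Σ_r ‖R(v_r)F(r) − m‖² ≤ (N/2)(L^e)²·Σ_ν Σ_{r_ν<n} ‖R(V(x_r,ν))F(r+e_ν) − F(r)‖² + 6N·d³n²(L^e)²a²·Σ_r ‖F(r)‖²` — the tree inequality `block_poincare_comb`
applied to `F − R(v⁻¹)m` (mean term zero), the covariant differences of the back-transported constant being comb-loop defects (§1) and the tree's
`Σ‖f‖²`-defect absorbed by `Σ‖R(v)F − m‖² ≤ 4Σ‖F‖²`. [cite: Balaban1983RegularityDecay, (2.27) p.580; Balaban1985Averaging, pp.24–25] -/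
theorem sum_normSq_conj_sub_mean_le {V : GaugeField P i (Matrix (Fin N) (Fin N) ℂ)ˣ} (hV : ∀ b, V b ∈ U1 (Matrix (Fin N) (Fin N) ℂ)) {a : ℝ}
    (ha : 0 ≤ a) (hplaq : ∀ (x : Site P i) (κ μ : Fin P.d), κ ≠ μ → ‖((holT V x (plaqWord κ μ) : (Matrix (Fin N) (Fin N) ℂ)ˣ) : Matrix (Fin N) (Fin N) ℂ) - 1‖ ≤ a)
    (h : P.sitesPerDir i = P.L ^ e * P.sitesPerDir i') (hn : n + 1 = P.L ^ e) (y : Site P i')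
    (F : (Fin P.d → Fin (n + 1)) → Matrix (Fin N) (Fin N) ℂ) :
    ∑ r : Fin P.d → Fin (n + 1), ‖conjR (holT V (bsite P i e hn y fun _ => 0) (treeWord fun ν => ((r ν : ℕ) : ℤ))) (F r)
        - (((n : ℝ) + 1) ^ P.d)⁻¹ • ∑ r' : Fin P.d → Fin (n + 1), conjR (holT V (bsite P i e hn y fun _ => 0) (treeWord fun ν => ((r' ν : ℕ) : ℤ))) (F r')‖ ^ 2
      ≤ (N / 2) * ((n : ℝ) + 1) ^ 2 * ∑ ν : Fin P.d, ∑ r ∈ univ.filter (fun r : Fin P.d → Fin (n + 1) => r ν ≠ Fin.last n),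
            ‖conjR (V ⟨bsite P i e hn y r, ν⟩) (F (stepUp r ν)) - F r‖ ^ 2
        + 6 * N * (P.d : ℝ) ^ 3 * (n : ℝ) ^ 2 * ((n : ℝ) + 1) ^ 2 * a ^ 2 * ∑ r : Fin P.d → Fin (n + 1), ‖F r‖ ^ 2 := by
  classical
  -- notation
  set ybar : Site P i := bsite P i e hn y fun _ => 0 with hybar
  set v : (Fin P.d → Fin (n + 1)) → (Matrix (Fin N) (Fin N) ℂ)ˣ := fun r => holT V ybar (treeWord fun ν => ((r ν : ℕ) : ℤ)) with hv
  set Vol : ℝ := ((n : ℝ) + 1) ^ P.d with hVol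
  set m : Matrix (Fin N) (Fin N) ℂ := Vol⁻¹ • ∑ r' : Fin P.d → Fin (n + 1), conjR (v r') (F r') with hm
  set g : (Fin P.d → Fin (n + 1)) → Matrix (Fin N) (Fin N) ℂ := fun r => F r - conjR (v r)⁻¹ m with hg
  set SF : ℝ := ∑ r : Fin P.d → Fin (n + 1), ‖F r‖ ^ 2 with hSF
  set G : ℝ := ∑ ν : Fin P.d, ∑ r ∈ univ.filter (fun r : Fin P.d → Fin (n + 1) => r ν ≠ Fin.last n),
      ‖conjR (V ⟨bsite P i e hn y r, ν⟩) (F (stepUp r ν)) - F r‖ ^ 2 with hG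
  have hVol0 : 0 < Vol := by positivity
  have hvm : ∀ r, v r ∈ U1 (Matrix (Fin N) (Fin N) ℂ) := fun r => holT_mem hV _ _
  have hcard : ((Finset.univ : Finset (Fin P.d → Fin (n + 1))).card : ℝ) = Vol := by
    rw [Finset.card_univ, Fintype.card_fun, Fintype.card_fin, Fintype.card_fin, hVol]; push_cast; ring
  -- the field on the torus sites (classical extension off the block; evaluated only on the block)
  have hinj := bsite_injective h hn y
  let f : Site P i → Matrix (Fin N) (Fin N) ℂ := fun x => if hx : ∃ r, bsite P i e hn y r = x then g hx.choose else 0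
  have hf : ∀ r, f (bsite P i e hn y r) = g r := by
    intro r
    have hx : ∃ r', bsite P i e hn y r' = bsite P i e hn y r := ⟨r, rfl⟩
    have h1 : f (bsite P i e hn y r) = g hx.choose := dif_pos hx
    rw [h1, hinj hx.choose_spec]
  -- the tree inequality for `f`
  have h227 := block_poincare_comb hV ha hplaq hn y f
  -- rewrite its four sums through `g`
  have eL : ∑ r : Fin P.d → Fin (n + 1), ‖f (bsite P i e hn y r)‖ ^ 2 = ∑ r : Fin P.d → Fin (n + 1), ‖g r‖ ^ 2 :=
    Finset.sum_congr rfl fun r _ => by rw [hf]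
  have eG : ∀ ν : Fin P.d, ∑ r ∈ univ.filter (fun r : Fin P.d → Fin (n + 1) => r ν ≠ Fin.last n),
        ‖conjR (V ⟨bsite P i e hn y r, ν⟩) (f ((bsite P i e hn y r).shift ν)) - f (bsite P i e hn y r)‖ ^ 2
      = ∑ r ∈ univ.filter (fun r : Fin P.d → Fin (n + 1) => r ν ≠ Fin.last n),
        ‖conjR (V ⟨bsite P i e hn y r, ν⟩) (g (stepUp r ν)) - g r‖ ^ 2 := by
    intro ν
    refine Finset.sum_congr rfl fun r hr => ?_
    have hr' : r ν ≠ Fin.last n := (Finset.mem_filter.mp hr).2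
    rw [← bsite_stepUp P hn y r ν hr', hf, hf]
  have eM : ∑ r : Fin P.d → Fin (n + 1), conjR (holT V ybar (treeWord fun ν => ((r ν : ℕ) : ℤ))) (f (bsite P i e hn y r)) = 0 := by
    have h1 : ∀ r, conjR (holT V ybar (treeWord fun ν => ((r ν : ℕ) : ℤ))) (f (bsite P i e hn y r)) = conjR (v r) (F r) - m := by
      intro r
      rw [hf, hg]
      simp only
      rw [conjR_sub, conjR_conjR, mul_inv_cancel, one_conjR]
    rw [Finset.sum_congr rfl fun r _ => h1 r, Finset.sum_sub_distrib, Finset.sum_const, hm, ← Nat.cast_smul_eq_nsmul ℝ, smul_smul]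
    have hc : (((Finset.univ : Finset (Fin P.d → Fin (n + 1))).card : ℕ) : ℝ) * Vol⁻¹ = 1 := by
      rw [hcard]; exact mul_inv_cancel₀ hVol0.ne'
    rw [hc, one_smul, sub_self]
  rw [eL, Finset.sum_congr rfl fun ν _ => eG ν, eM, norm_zero] at h227
  simp only [zero_pow two_ne_zero, mul_zero, add_zero] at h227
  -- `‖g r‖ = ‖R(v_r)F(r) − m‖`
  have hgn : ∀ r, ‖g r‖ = ‖conjR (v r) (F r) - m‖ := by
    intro r
    rw [← norm_conjR (hvm r) (g r), hg]
    simp only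
    rw [conjR_sub, conjR_conjR, mul_inv_cancel, one_conjR]
  set S : ℝ := ∑ r : Fin P.d → Fin (n + 1), ‖conjR (v r) (F r) - m‖ ^ 2 with hS
  have eS : ∑ r : Fin P.d → Fin (n + 1), ‖g r‖ ^ 2 = S := Finset.sum_congr rfl fun r _ => by rw [hgn]
  rw [eS] at h227
  -- Jensen: `Vol‖m‖² ≤ Σ‖F‖²`
  have hJ : Vol * ‖m‖ ^ 2 ≤ SF := normSq_mean_le hV hn y F
  -- `S ≤ 4Σ‖F‖²`
  have hS4 : S ≤ 4 * SF := by
    have hpt : ∀ r, ‖conjR (v r) (F r) - m‖ ^ 2 ≤ 2 * ‖F r‖ ^ 2 + 2 * ‖m‖ ^ 2 := by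
      intro r
      have h1 : ‖conjR (v r) (F r) - m‖ ≤ ‖F r‖ + ‖m‖ := by
        calc _ ≤ ‖conjR (v r) (F r)‖ + ‖m‖ := norm_sub_le _ _
          _ = ‖F r‖ + ‖m‖ := by rw [norm_conjR (hvm r)]
      have h0 : 0 ≤ ‖conjR (v r) (F r) - m‖ := norm_nonneg _
      nlinarith [sq_nonneg (‖F r‖ - ‖m‖)]
    calc S ≤ ∑ r : Fin P.d → Fin (n + 1), (2 * ‖F r‖ ^ 2 + 2 * ‖m‖ ^ 2) := Finset.sum_le_sum fun r _ => hpt r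
      _ = 2 * SF + 2 * (Vol * ‖m‖ ^ 2) := by
          rw [Finset.sum_add_distrib, ← Finset.mul_sum, Finset.sum_const, nsmul_eq_mul, hcard]; ring
      _ ≤ 4 * SF := by linarith
  -- the gradient of `g`: true gradient plus the comb-loop defect of the back-transported mean
  have hgrad : ∑ ν : Fin P.d, ∑ r ∈ univ.filter (fun r : Fin P.d → Fin (n + 1) => r ν ≠ Fin.last n),
        ‖conjR (V ⟨bsite P i e hn y r, ν⟩) (g (stepUp r ν)) - g r‖ ^ 2
      ≤ 2 * G + 8 * (P.d : ℝ) ^ 3 * (n : ℝ) ^ 2 * a ^ 2 * SF := by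
    have hpt : ∀ (ν : Fin P.d) (r : Fin P.d → Fin (n + 1)), r ν ≠ Fin.last n →
        ‖conjR (V ⟨bsite P i e hn y r, ν⟩) (g (stepUp r ν)) - g r‖ ^ 2
          ≤ 2 * ‖conjR (V ⟨bsite P i e hn y r, ν⟩) (F (stepUp r ν)) - F r‖ ^ 2 + 8 * ((P.d * n * a) ^ 2 * ‖m‖ ^ 2) := by
      intro ν r hr
      -- the defect
      have hD := norm_conjR_inv_frame_step_le hV ha hplaq ybar (fun κ => ((r κ : ℕ) : ℤ)) ν m
      rw [← intVec_stepUp r ν hr, ← bsite_eq_transl hn y r] at hD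
      have hl1 : (l1 (fun κ => ((r κ : ℕ) : ℤ)) : ℝ) * a ≤ P.d * n * a := mul_le_mul_of_nonneg_right (l1_intVec_le r) ha
      have hD' : ‖conjR (V ⟨bsite P i e hn y r, ν⟩) (conjR (v (stepUp r ν))⁻¹ m) - conjR (v r)⁻¹ m‖ ≤ 2 * (P.d * n * a) * ‖m‖ := by
        refine hD.trans ?_
        have := mul_le_mul_of_nonneg_right hl1 (norm_nonneg m)
        linarith
      -- split
      have hsplit : conjR (V ⟨bsite P i e hn y r, ν⟩) (g (stepUp r ν)) - g r
          = (conjR (V ⟨bsite P i e hn y r, ν⟩) (F (stepUp r ν)) - F r)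
            - (conjR (V ⟨bsite P i e hn y r, ν⟩) (conjR (v (stepUp r ν))⁻¹ m) - conjR (v r)⁻¹ m) := by
        simp only [hg, conjR_sub]; abel
      rw [hsplit]
      have hA0 := norm_nonneg (conjR (V ⟨bsite P i e hn y r, ν⟩) (F (stepUp r ν)) - F r)
      have hB0 := norm_nonneg (conjR (V ⟨bsite P i e hn y r, ν⟩) (conjR (v (stepUp r ν))⁻¹ m) - conjR (v r)⁻¹ m)
      have hdna : 0 ≤ P.d * n * a := by positivity
      calc ‖(conjR (V ⟨bsite P i e hn y r, ν⟩) (F (stepUp r ν)) - F r)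
              - (conjR (V ⟨bsite P i e hn y r, ν⟩) (conjR (v (stepUp r ν))⁻¹ m) - conjR (v r)⁻¹ m)‖ ^ 2
          ≤ (‖conjR (V ⟨bsite P i e hn y r, ν⟩) (F (stepUp r ν)) - F r‖
              + ‖conjR (V ⟨bsite P i e hn y r, ν⟩) (conjR (v (stepUp r ν))⁻¹ m) - conjR (v r)⁻¹ m‖) ^ 2 :=
            pow_le_pow_left₀ (norm_nonneg _) (norm_sub_le _ _) 2
        _ ≤ 2 * ‖conjR (V ⟨bsite P i e hn y r, ν⟩) (F (stepUp r ν)) - F r‖ ^ 2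
              + 2 * ‖conjR (V ⟨bsite P i e hn y r, ν⟩) (conjR (v (stepUp r ν))⁻¹ m) - conjR (v r)⁻¹ m‖ ^ 2 := by
            nlinarith [sq_nonneg (‖conjR (V ⟨bsite P i e hn y r, ν⟩) (F (stepUp r ν)) - F r‖
              - ‖conjR (V ⟨bsite P i e hn y r, ν⟩) (conjR (v (stepUp r ν))⁻¹ m) - conjR (v r)⁻¹ m‖)]
        _ ≤ 2 * ‖conjR (V ⟨bsite P i e hn y r, ν⟩) (F (stepUp r ν)) - F r‖ ^ 2 + 2 * (2 * (P.d * n * a) * ‖m‖) ^ 2 := by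
            have := pow_le_pow_left₀ hB0 hD' 2
            linarith
        _ = _ := by ring
    -- sum: the defect summand does not depend on `r`; the filter has at most `Vol` elements per direction
    have hs : ∀ ν : Fin P.d, ∑ r ∈ univ.filter (fun r : Fin P.d → Fin (n + 1) => r ν ≠ Fin.last n),
          ‖conjR (V ⟨bsite P i e hn y r, ν⟩) (g (stepUp r ν)) - g r‖ ^ 2
        ≤ 2 * ∑ r ∈ univ.filter (fun r : Fin P.d → Fin (n + 1) => r ν ≠ Fin.last n), ‖conjR (V ⟨bsite P i e hn y r, ν⟩) (F (stepUp r ν)) - F r‖ ^ 2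
          + Vol * (8 * ((P.d * n * a) ^ 2 * ‖m‖ ^ 2)) := by
      intro ν
      calc _ ≤ ∑ r ∈ univ.filter (fun r : Fin P.d → Fin (n + 1) => r ν ≠ Fin.last n),
              (2 * ‖conjR (V ⟨bsite P i e hn y r, ν⟩) (F (stepUp r ν)) - F r‖ ^ 2 + 8 * ((P.d * n * a) ^ 2 * ‖m‖ ^ 2)) :=
            Finset.sum_le_sum fun r hr => hpt ν r (Finset.mem_filter.mp hr).2
        _ = 2 * ∑ r ∈ univ.filter (fun r : Fin P.d → Fin (n + 1) => r ν ≠ Fin.last n), ‖conjR (V ⟨bsite P i e hn y r, ν⟩) (F (stepUp r ν)) - F r‖ ^ 2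
            + ((univ.filter (fun r : Fin P.d → Fin (n + 1) => r ν ≠ Fin.last n)).card : ℝ) * (8 * ((P.d * n * a) ^ 2 * ‖m‖ ^ 2)) := by
            rw [Finset.sum_add_distrib, Finset.mul_sum, Finset.sum_const, nsmul_eq_mul]
        _ ≤ _ := by
            have hc : ((univ.filter (fun r : Fin P.d → Fin (n + 1) => r ν ≠ Fin.last n)).card : ℝ) ≤ Vol := by
              rw [← hcard]; exact_mod_cast Finset.card_filter_le _ _
            have h8 : 0 ≤ 8 * ((P.d * n * a) ^ 2 * ‖m‖ ^ 2) := by positivity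
            linarith [mul_le_mul_of_nonneg_right hc h8]
    calc _ ≤ ∑ ν : Fin P.d, (2 * ∑ r ∈ univ.filter (fun r : Fin P.d → Fin (n + 1) => r ν ≠ Fin.last n),
            ‖conjR (V ⟨bsite P i e hn y r, ν⟩) (F (stepUp r ν)) - F r‖ ^ 2 + Vol * (8 * ((P.d * n * a) ^ 2 * ‖m‖ ^ 2))) :=
          Finset.sum_le_sum fun ν _ => hs ν
      _ = 2 * G + P.d * (Vol * (8 * ((P.d * n * a) ^ 2 * ‖m‖ ^ 2))) := by
          rw [Finset.sum_add_distrib, ← Finset.mul_sum, Finset.sum_const, Finset.card_univ, Fintype.card_fin, nsmul_eq_mul, hG]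
      _ = 2 * G + 8 * (P.d : ℝ) ^ 3 * (n : ℝ) ^ 2 * a ^ 2 * (Vol * ‖m‖ ^ 2) := by ring
      _ ≤ 2 * G + 8 * (P.d : ℝ) ^ 3 * (n : ℝ) ^ 2 * a ^ 2 * SF := by
          have h0 : 0 ≤ 8 * (P.d : ℝ) ^ 3 * (n : ℝ) ^ 2 * a ^ 2 := by positivity
          linarith [mul_le_mul_of_nonneg_left hJ h0]
  -- assemble: `S ≤ (N/4)(n+1)²(2G + 8d³n²a²SF) + N d (dna)²(n+1)² S`, `S ≤ 4 SF`
  have hN0 : (0 : ℝ) ≤ N / 4 * ((n : ℝ) + 1) ^ 2 := by positivity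
  have hdef0 : (0 : ℝ) ≤ N * (P.d * ((P.d * n * a) ^ 2 * ((n : ℝ) + 1) ^ 2)) := by positivity
  have h1 := mul_le_mul_of_nonneg_left hgrad hN0
  have h2 := mul_le_mul_of_nonneg_left hS4 hdef0
  have hmain : S ≤ N / 4 * ((n : ℝ) + 1) ^ 2 * (2 * G + 8 * (P.d : ℝ) ^ 3 * (n : ℝ) ^ 2 * a ^ 2 * SF)
      + N * (P.d * ((P.d * n * a) ^ 2 * ((n : ℝ) + 1) ^ 2)) * (4 * SF) := by linarith [h227]
  refine hmain.trans (le_of_eq ?_)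
  ring

/-- ★ **SUP FORM** (the `hosc` input of `Prop7CovCombMeanCentred.norm_covCombMean_le_osc`): every single frame-read deviation is bounded by the square root of the
right-hand side of `sum_normSq_conj_sub_mean_le`. [cite: Balaban1983RegularityDecay, (2.27) p.580] -/
theorem normSq_conj_sub_mean_le_sum {V : GaugeField P i (Matrix (Fin N) (Fin N) ℂ)ˣ} (hV : ∀ b, V b ∈ U1 (Matrix (Fin N) (Fin N) ℂ)) {a : ℝ}
    (ha : 0 ≤ a) (hplaq : ∀ (x : Site P i) (κ μ : Fin P.d), κ ≠ μ → ‖((holT V x (plaqWord κ μ) : (Matrix (Fin N) (Fin N) ℂ)ˣ) : Matrix (Fin N) (Fin N) ℂ) - 1‖ ≤ a)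
    (h : P.sitesPerDir i = P.L ^ e * P.sitesPerDir i') (hn : n + 1 = P.L ^ e) (y : Site P i')
    (F : (Fin P.d → Fin (n + 1)) → Matrix (Fin N) (Fin N) ℂ) (r₀ : Fin P.d → Fin (n + 1)) :
    ‖conjR (holT V (bsite P i e hn y fun _ => 0) (treeWord fun ν => ((r₀ ν : ℕ) : ℤ))) (F r₀)
        - (((n : ℝ) + 1) ^ P.d)⁻¹ • ∑ r' : Fin P.d → Fin (n + 1), conjR (holT V (bsite P i e hn y fun _ => 0) (treeWord fun ν => ((r' ν : ℕ) : ℤ))) (F r')‖ ^ 2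
      ≤ (N / 2) * ((n : ℝ) + 1) ^ 2 * ∑ ν : Fin P.d, ∑ r ∈ univ.filter (fun r : Fin P.d → Fin (n + 1) => r ν ≠ Fin.last n),
            ‖conjR (V ⟨bsite P i e hn y r, ν⟩) (F (stepUp r ν)) - F r‖ ^ 2
        + 6 * N * (P.d : ℝ) ^ 3 * (n : ℝ) ^ 2 * ((n : ℝ) + 1) ^ 2 * a ^ 2 * ∑ r : Fin P.d → Fin (n + 1), ‖F r‖ ^ 2 := by
  refine le_trans ?_ (sum_normSq_conj_sub_mean_le hV ha hplaq h hn y F)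
  exact Finset.single_le_sum (f := fun r => ‖conjR (holT V (bsite P i e hn y fun _ => 0) (treeWord fun ν => ((r ν : ℕ) : ℤ))) (F r)
      - (((n : ℝ) + 1) ^ P.d)⁻¹ • ∑ r' : Fin P.d → Fin (n + 1), conjR (holT V (bsite P i e hn y fun _ => 0) (treeWord fun ν => ((r' ν : ℕ) : ℤ))) (F r')‖ ^ 2)
    (fun r _ => sq_nonneg _) (Finset.mem_univ r₀)

end Summit.QuantumFields.YangMills.Theorems.Prop7CovBlockPoincareCentred

end
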